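import Mathlib

/-!
# Hidden corner lemma (R): the F-side defect bound (Theorem 2)

Let `Z` be the lower shift on `ℂ^N`, `T(X) = ∑ X a b • T a b` a pencil hiding the corner
`T(X) E = F X`, with `ΛE E = 1`, `ΛF F = 1`.  Assume that at some good point `X` the matrix
`T(X)` is invertible, that the inverse `S := T(X)⁻¹` has Stein displacement rank `≤ d` for the
swapped pair, i.e. `rank (S - Zᵀ S Z) ≤ d`, and that the `r × r` block
`M := X⁻¹ - (ΛE Zᵀ E) X⁻¹ (ΛF Z F)` is invertible.  Then
`r ≤ d + rank ((1 - F ΛF) Z F)`.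

Proof.  `rank M = r` since `M` is invertible.  If `X` is singular then (Mathlib convention)
`X⁻¹ = 0`, so `M = 0` and `r = 0`.  Otherwise from `T(X) E = F X` we get `S F = E X⁻¹`, and with
`K := (1 - F ΛF) Z F` one has `Z F = F (ΛF Z F) + K`, whence the identity
`M = ΛE (S - Zᵀ S Z) F + ΛE Zᵀ S K`.
Subadditivity of rank and `rank (A B) ≤ min (rank A) (rank B)` give
`r = rank M ≤ rank (S - Zᵀ S Z) + rank K ≤ d + rank K`.
-/

set_option linter.dupNamespace false

namespace Summit.MatrixMultiplication.MatrixMultiplication.Theorems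

open scoped Matrix

/-- Subadditivity of the rank of complex matrices: `rank (A + B) ≤ rank A + rank B`. -/
private lemma hclR_rank_add_le_aux {m n : Type*} [Fintype m] [Fintype n]
    (A B : Matrix m n ℂ) : (A + B).rank ≤ A.rank + B.rank := by
  unfold Matrix.rank
  rw [Matrix.mulVecLin_add]
  exact (Submodule.finrank_mono (LinearMap.range_add_le _ _)).trans
    (Submodule.finrank_add_le_finrank_add_finrank _ _)

/-- F-side defect bound (Theorem 2): the inverse family `T(X)⁻¹` hides the reversed corner
`T(X)⁻¹ F = E X⁻¹` and is Toeplitz-like for the swapped pair; reading the (1,1) block at a good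
point gives `r ≤ d + rank ((1 − F ΛF) Z F)`. The "good point" and the inverse-displacement bound
are supplied as hypotheses (`hgood`, `hinv`). -/
theorem hclR_defect_bound_F (r N d : ℕ) (T : Fin r → Fin r → Matrix (Fin N) (Fin N) ℂ)
    (E F : Matrix (Fin N) (Fin r) ℂ)
    (ΛE : Matrix (Fin r) (Fin N) ℂ) (hΛE : ΛE * E = 1)
    (ΛF : Matrix (Fin r) (Fin N) ℂ) (hΛF : ΛF * F = 1)
    (hcorner : ∀ X : Matrix (Fin r) (Fin r) ℂ, (∑ a : Fin r, ∑ b : Fin r, X a b • T a b) * E = F * X)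
    (hinv : ∀ X : Matrix (Fin r) (Fin r) ℂ, IsUnit (∑ a : Fin r, ∑ b : Fin r, X a b • T a b).det →
        ((∑ a : Fin r, ∑ b : Fin r, X a b • T a b)⁻¹ -
        (Matrix.of fun i j : Fin N => if (i : ℕ) = (j : ℕ) + 1 then (1 : ℂ) else 0)ᵀ *
        (∑ a : Fin r, ∑ b : Fin r, X a b • T a b)⁻¹ *
        (Matrix.of fun i j : Fin N => if (i : ℕ) = (j : ℕ) + 1 then (1 : ℂ) else 0)).rank ≤ d)
    (hgood : ∃ X : Matrix (Fin r) (Fin r) ℂ, IsUnit (∑ a : Fin r, ∑ b : Fin r, X a b • T a b).det ∧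
        IsUnit (X⁻¹ - (ΛE * (Matrix.of fun i j : Fin N => if (i : ℕ) = (j : ℕ) + 1 then (1 : ℂ) else 0)ᵀ * E) * X⁻¹ *
          (ΛF * (Matrix.of fun i j : Fin N => if (i : ℕ) = (j : ℕ) + 1 then (1 : ℂ) else 0) * F)).det) :
    r ≤ d + ((1 - F * ΛF) * (Matrix.of fun i j : Fin N => if (i : ℕ) = (j : ℕ) + 1 then (1 : ℂ) else 0) * F).rank := by
  -- `hΛF` belongs to the agreed signature of this stub but is not needed for the bound.
  have _hΛF : ΛF * F = 1 := hΛF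
  obtain ⟨X, hu, hM⟩ := hgood
  have hD := hinv X hu
  have hcE := hcorner X
  set Z : Matrix (Fin N) (Fin N) ℂ :=
    (Matrix.of fun i j : Fin N => if (i : ℕ) = (j : ℕ) + 1 then (1 : ℂ) else 0)
  set TX : Matrix (Fin N) (Fin N) ℂ := ∑ a : Fin r, ∑ b : Fin r, X a b • T a b
  -- the good-point block is invertible, hence has full rank `r`
  have hr : (X⁻¹ - ΛE * Zᵀ * E * X⁻¹ * (ΛF * Z * F)).rank = r := by
    rw [Matrix.rank_of_isUnit _ ((Matrix.isUnit_iff_isUnit_det _).mpr hM), Fintype.card_fin]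
  refine hr.symm.trans_le ?_
  by_cases hX : IsUnit X.det
  · -- `X` is invertible: derive the reversed corner `S F = E X⁻¹` for `S = T(X)⁻¹`
    have hS : TX⁻¹ * TX = 1 := Matrix.nonsing_inv_mul _ hu
    have hXX : X * X⁻¹ = 1 := Matrix.mul_nonsing_inv _ hX
    have hSF : TX⁻¹ * F = E * X⁻¹ := by
      calc TX⁻¹ * F = TX⁻¹ * F * (X * X⁻¹) := by rw [hXX, Matrix.mul_one]
        _ = TX⁻¹ * (F * X) * X⁻¹ := by simp only [Matrix.mul_assoc]
        _ = TX⁻¹ * TX * E * X⁻¹ := by rw [← hcE]; simp only [Matrix.mul_assoc]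
        _ = E * X⁻¹ := by rw [hS, Matrix.one_mul]
    -- the displacement part
    have hP : ΛE * (TX⁻¹ - Zᵀ * TX⁻¹ * Z) * F = X⁻¹ - ΛE * (Zᵀ * (TX⁻¹ * (Z * F))) := by
      simp only [Matrix.mul_sub, Matrix.sub_mul, Matrix.mul_assoc]
      rw [hSF, ← Matrix.mul_assoc ΛE E, hΛE, Matrix.one_mul]
    -- the defect part
    have hQ : ΛE * Zᵀ * TX⁻¹ * ((1 - F * ΛF) * Z * F) =
        ΛE * (Zᵀ * (TX⁻¹ * (Z * F))) - ΛE * (Zᵀ * (E * (X⁻¹ * (ΛF * (Z * F))))) := by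
      simp only [Matrix.sub_mul, Matrix.mul_sub, Matrix.one_mul, Matrix.mul_assoc]
      rw [← Matrix.mul_assoc TX⁻¹ F, hSF, Matrix.mul_assoc E X⁻¹]
    -- the block identity `M = ΛE D' F + ΛE Zᵀ S K`
    have hMeq : X⁻¹ - ΛE * Zᵀ * E * X⁻¹ * (ΛF * Z * F) =
        ΛE * (TX⁻¹ - Zᵀ * TX⁻¹ * Z) * F + ΛE * Zᵀ * TX⁻¹ * ((1 - F * ΛF) * Z * F) := by
      rw [hP, hQ, sub_add_sub_cancel]
      simp only [Matrix.mul_assoc]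
    rw [hMeq]
    calc (ΛE * (TX⁻¹ - Zᵀ * TX⁻¹ * Z) * F + ΛE * Zᵀ * TX⁻¹ * ((1 - F * ΛF) * Z * F)).rank
        ≤ (ΛE * (TX⁻¹ - Zᵀ * TX⁻¹ * Z) * F).rank +
            (ΛE * Zᵀ * TX⁻¹ * ((1 - F * ΛF) * Z * F)).rank := hclR_rank_add_le_aux _ _
      _ ≤ (TX⁻¹ - Zᵀ * TX⁻¹ * Z).rank + ((1 - F * ΛF) * Z * F).rank :=
          add_le_add ((Matrix.rank_mul_le_left _ _).trans (Matrix.rank_mul_le_right _ _))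
            (Matrix.rank_mul_le_right _ _)
      _ ≤ d + ((1 - F * ΛF) * Z * F).rank := Nat.add_le_add_right hD _
  · -- `X` singular: `X⁻¹ = 0`, so the block vanishes
    rw [Matrix.nonsing_inv_apply_not_isUnit _ hX]
    simp

end Summit.MatrixMultiplication.MatrixMultiplication.Theorems
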